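/-
Origin: expansion seat `prover-pub-hodgecm-mc-carch-1-g5-0`, handover #CA52 2026-08-20T11:16:29Z md5 32089fe0a59c (379 l., 12 decls; NEW additive leaf; imports #CA51 (this kit) + installed #CA38 Model.ArchKTypeOfSigmaIotaVal + RUN-49 #CA49 Model.ArchKTypeOfLineTables34 + (K7) Model.ArchConjTorusTransport; RUN 50; INSTALL after #CA51; drops with #CA51; cert certs/ax-ArchKTypeOfSigmaIotaConj-32089fe0a59c.log: rc 0 / 54 s / 0 warnings / trio) (`HOME/mc/pub-hodgecm-mc-carch-1/pkg50/HodgeCM/Model/ArchKTypeOfSigmaIotaConj.lean`, md5 32089fe0a59c, 379 lines);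
landed by the second packager p2 gen 7 (p2-g7) in gate run 50 as `HodgeCM/Model/ArchKTypeOfSigmaIotaConj.lean` (verbatim).
-/
/-
Copyright (c) 2026. Released under Apache 2.0 license as described in the file LICENSE.
Cell pub-hodgecm, MODEL layer (construction prover mc-carch-1, gen 5), BINDER-OWNERS rows 12 / 17–19, junction (C-Σ)′ AT `v₁`:
the VALUE of the conjugated see-saw exponent `ℓ″` — `eP² + eP³ + ℓ″ = eP⁰ + eP¹ + ℓ` — from the see-saw of the two CONJUGATED line vacua.
-/
import Summits.HodgeConjecture.HodgeCM.Model.ArchKTypeOfSigmaIotaVal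
import Summits.HodgeConjecture.HodgeCM.Model.ArchKTypeOfLambdaConj
import Summits.HodgeConjecture.HodgeCM.Model.ArchKTypeOfLineTables34
import Summits.HodgeConjecture.HodgeCM.Model.ArchConjTorusTransport_2

/-!
# (C-Σ)′ at `v₁`: the conjugated see-saw discrepancy on `K_∞` and the R1/R2 consistency at the place of `ι₁`

Lines 2, 3 at pin R2 carry `c₂ = χV(det)·ν′⁻¹·Λ₀″` and `c₃ = ν′` on the `ι₁`-section, with `Λ₀″ = lambdaCharConj` (#CA51) of type `ℓ″ =
lambdaExponentConj` on `K_∞ = Stab(x₀)`.  The (χ)₂ socket (#CA51 `hχ_two_of_archType`) at the SHARED `χV := χVR` (type `nVR (mk ι₁) = −eP⁰ − eP¹ − ℓ`,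
#CA33) and `ν′` of type `n₃R (mk ι₁) = −eP³` (#CA49) needs exactly

  **(C-Σ)′ at `v₁`:  `lambdaExponentConj + eP² + eP³ = lambdaExponent + eP⁰ + eP¹`**  (under E's guard `(mk ι₁).embedding = ι₁`).

Proof = the #CA37/#CA38 one-vector see-saw run on the CONJUGATED tensor of the two line-2′/3′ VACUA `X′ = φ(vac₂′) ⊗‴ φ(vac₃′)` at the one-place
element `u_x` of a `v₁`-letter `x = (A, D)`: line sides (§ 1) `Λ₀″(u_x) · vacScalar e₂ (letterK x)` and `vacScalar e₃ (letterK x)` (the generic line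
lemma of #CA37 § 1 at `hGR₂/hGR₃`, `lineSign_two/three`; K-1 `cmConjLineRepFin₀/₁_apply_eq_smul_cmPairRep`); big side (§ 2) through the vacuum
instance `hSV₁` of the letter-generic (STRIP) ∧ (VT) (period-1 #P48a clause 3 + sinst-1 #1225 + (K9) `follandFock_planeFrame_dW'_conjFrameTransport` at
`F = 1`): `X′ = E(Y ⊗ F)`, `Y = a • ω_∞(hGR)(1, conjTransportK c.D)(follandFock 𝔢 1)`, on which `ω_∞(u_x, 1)` acts by `pinLetterChar(x)` (binder-2 #72
`cmArchWeilRep_archSingle_uOfLetter_follandFock_one`; `(u,1)` and `(1,k)` commute in the representation of the PRODUCT group — no cocycle).  Hence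
(§ 3) `pinLetterChar(x) = Λ₀″(u_x) · vacScalar e₂ · vacScalar e₃`; with `Λ₀″(u_x) = tw(det A · det D)^{ℓ″}` (§ 3, twin of #CA38 § 3 over #CA51) and #CA38's
closed form `pinLetterChar(x) = tw(det A·det D)^ℓ · (det A^{eP⁰} det D^{eQ⁰}) · (det A^{eP¹} det D^{eQ¹})`, the letter `x = (1, z)` and `e_P − e_Q = 1` on
all four lines give the identity (§ 4, #CA21 `int_eq_zero_of_forall_norm_one_zpow_eq_one`).  § 5: the R2 value at `w(ι₁)`:
**`nVR (mk ι₁) = −eP² − eP³ − lambdaExponentConj`** — the type the (χ)₂ socket needs, now a theorem modulo `hSV₁`.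

Hypothesis shape: `hSV₁` is per context `(V, c)`, quantified over the rational centres `x₂ x₃` of the two vacuum test functions; it is the vacuum
companion of theta-3 (K10)'s `hSV` and is discharged by the same period-1/sinst-1 assembly.  0 records, 0 `def … : Prop`, nothing cited as a hypothesis.
-/

set_option autoImplicit false

noncomputable section

open NumberField NumberField.InfinitePlace NumberField.mixedEmbedding IsDedekindDomain
open scoped Matrix Classical TensorProduct SchwartzMap
open ComplexConjugate MvPolynomial
open Literature.NumberTheory.Automorphic Literature.NumberTheory.Automorphic.UnitaryGroup Literature.NumberTheory.Weil1964
open Literature.NumberTheory.GelbartRogawski1991 Literature.NumberTheory.GelbartRogawski1991.UnitaryDualPair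
open Literature.RepresentationTheory.KonnoKonno2007 Literature.RepresentationTheory.KonnoKonno2007.RealDualPair
open Literature.RepresentationTheory (atPlace)
open Literature.Analysis.SegalBargmann
open HodgeCM.Adelic HodgeCM.PerL34 HodgeCM.Model.HypCensus HodgeCM.Model.ArchSideTerm HodgeCM.Model.SupplyInstance

namespace HodgeCM.Model

section IotaConj

open Literature.Geometry.ComplexHyperbolic.BallModel (U21 x₀ mat)

variable {L : CMField} {ι₁ : L →+* ℂ} (V : HermSpace3 L ι₁) (c : SeesawCtx L)
variable
  (hGR : (cmSplittingDatum (L : Type) finProdFinEquiv (frameD V) (frameD_real V) (frameD_ne V) (dW c.D) (dW_real c.D) (dW_ne c.D)).CompatibleSplitting)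
  (hGR₀ : (cmSplittingDatum (L : Type) (e₁) (frameD V) (frameD_real V) (frameD_ne V) (lineVec (L : Type) (dW c.D 0))
    (fun _ => dW_real c.D 0) (fun _ => dW_ne c.D 0)).CompatibleSplitting)
  (hGR₁ : (cmSplittingDatum (L : Type) (e₁) (frameD V) (frameD_real V) (frameD_ne V) (lineVec (L : Type) (dW c.D 1))
    (fun _ => dW_real c.D 1) (fun _ => dW_ne c.D 1)).CompatibleSplitting)
  (hGR₂ : (cmSplittingDatum (L : Type) (e₁) (frameD V) (frameD_real V) (frameD_ne V) (lineVec (L : Type) (dW' c.D 0))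
    (fun _ => dW'_real c.D 0) (fun _ => dW'_ne c.D 0)).CompatibleSplitting)
  (hGR₃ : (cmSplittingDatum (L : Type) (e₁) (frameD V) (frameD_real V) (frameD_ne V) (lineVec (L : Type) (dW' c.D 1))
    (fun _ => dW'_real c.D 1) (fun _ => dW'_ne c.D 1)).CompatibleSplitting)
  (h₁W : (∀ j, 0 < (ι₁ (dW c.D j)).re) ∨ ∀ j, (ι₁ (dW c.D j)).re < 0)
  (hpos₀ : 0 < cmXW (L : Type) (frameD V) (lineVec (L : Type) (dW c.D 0)) (fun _ => dW_real c.D 0) ι₁ (HypCensus.cmPlace (L : Type) ι₁) 0)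
  (hpos₁ : 0 < cmXW (L : Type) (frameD V) (lineVec (L : Type) (dW c.D 1)) (fun _ => dW_real c.D 1) ι₁ (HypCensus.cmPlace (L : Type) ι₁) 0)
  (hpos₂ : 0 < cmXW (L : Type) (frameD V) (lineVec (L : Type) (dW' c.D 0)) (fun _ => dW'_real c.D 0) ι₁ (HypCensus.cmPlace (L : Type) ι₁) 0)
  (hpos₃ : 0 < cmXW (L : Type) (frameD V) (lineVec (L : Type) (dW' c.D 1)) (fun _ => dW'_real c.D 1) ι₁ (HypCensus.cmPlace (L : Type) ι₁) 0)

/-! ## § 1 The conjugated lines on their vacua at the one-place element of a `v₁`-letter -/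

/-- line 2 on its vacuum at the one-place element of a `v₁`-letter: `vacScalar e₂ (letterK x)`. -/
theorem cmArchWeilRep_two_archSingle_uOfLetter_follandFock_one (x : Matrix.unitaryGroup (PosIdx (cmXV (L : Type) (frameD V) (frameD_real V) ι₁ (cmPlace (L : Type) ι₁))) ℂ × Matrix.unitaryGroup (NegIdx (cmXV (L : Type) (frameD V) (frameD_real V) ι₁ (cmPlace (L : Type) ι₁))) ℂ) :
    cmArchWeilRep (L : Type) e₁ (frameD V) (frameD_real V) (frameD_ne V) (lineVec (L : Type) (dW' c.D 0)) (fun _ => dW'_real c.D 0)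
        (fun _ => dW'_ne c.D 0) hGR₂
        ((UnitaryGroup.archSingle (↥(maximalRealSubfield L)) L (IsCMField.complexConj L) 3 (Matrix.diagonal (frameD V))
            (IsCMField.complexConj_ne_one L) (UnitaryGroup.complexConj_smul_infinitePlace (L : Type)) (cmPlaceOver (L : Type) (cmPlace (L : Type) ι₁))
            (uOfLetter (L : Type) (frameD V) (frameD_real V) (frameD_ne V) (dW c.D) (dW_real c.D) (dW_ne c.D) ι₁ (cmPlace (L : Type) ι₁) x)),
          1)
        (follandFock (cmBigFrame (L : Type) e₁ (frameD V) (frameD_real V) (frameD_ne V) (lineVec (L : Type) (dW' c.D 0)) (fun _ => dW'_real c.D 0) (fun _ => dW'_ne c.D 0) ι₁) 1) =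
      vacScalar (lineVacExponentsTwo V c hGR₂ (posIdxEquivUnit hpos₂) (negIdxEquivEmpty hpos₂)) (letterK V x : DPK (Fin 2) Unit Unit Empty) • (follandFock (cmBigFrame (L : Type) e₁ (frameD V) (frameD_real V) (frameD_ne V) (lineVec (L : Type) (dW' c.D 0)) (fun _ => dW'_real c.D 0) (fun _ => dW'_ne c.D 0) ι₁) 1) :=
  cmArchWeilRep_line_archSingle_uOfLetter_follandFock_one V c.D (dW' c.D 0) (dW'_real c.D 0) (dW'_ne c.D 0) hGR₂ (posIdxEquivUnit hpos₂)
    (negIdxEquivEmpty hpos₂) (lineSign_two V c) (exists_isArchWeilDatum_lineSlot (R := Unit) (S := Empty)) x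

/-- line 3 on its vacuum at the one-place element of a `v₁`-letter: `vacScalar e₃ (letterK x)`. -/
theorem cmArchWeilRep_three_archSingle_uOfLetter_follandFock_one (x : Matrix.unitaryGroup (PosIdx (cmXV (L : Type) (frameD V) (frameD_real V) ι₁ (cmPlace (L : Type) ι₁))) ℂ × Matrix.unitaryGroup (NegIdx (cmXV (L : Type) (frameD V) (frameD_real V) ι₁ (cmPlace (L : Type) ι₁))) ℂ) :
    cmArchWeilRep (L : Type) e₁ (frameD V) (frameD_real V) (frameD_ne V) (lineVec (L : Type) (dW' c.D 1)) (fun _ => dW'_real c.D 1)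
        (fun _ => dW'_ne c.D 1) hGR₃
        ((UnitaryGroup.archSingle (↥(maximalRealSubfield L)) L (IsCMField.complexConj L) 3 (Matrix.diagonal (frameD V))
            (IsCMField.complexConj_ne_one L) (UnitaryGroup.complexConj_smul_infinitePlace (L : Type)) (cmPlaceOver (L : Type) (cmPlace (L : Type) ι₁))
            (uOfLetter (L : Type) (frameD V) (frameD_real V) (frameD_ne V) (dW c.D) (dW_real c.D) (dW_ne c.D) ι₁ (cmPlace (L : Type) ι₁) x)),
          1)
        (follandFock (cmBigFrame (L : Type) e₁ (frameD V) (frameD_real V) (frameD_ne V) (lineVec (L : Type) (dW' c.D 1)) (fun _ => dW'_real c.D 1) (fun _ => dW'_ne c.D 1) ι₁) 1) =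
      vacScalar (lineVacExponentsThree V c hGR₃ (posIdxEquivUnit hpos₃) (negIdxEquivEmpty hpos₃)) (letterK V x : DPK (Fin 2) Unit Unit Empty) • (follandFock (cmBigFrame (L : Type) e₁ (frameD V) (frameD_real V) (frameD_ne V) (lineVec (L : Type) (dW' c.D 1)) (fun _ => dW'_real c.D 1) (fun _ => dW'_ne c.D 1) ι₁) 1) :=
  cmArchWeilRep_line_archSingle_uOfLetter_follandFock_one V c.D (dW' c.D 1) (dW'_real c.D 1) (dW'_ne c.D 1) hGR₃ (posIdxEquivUnit hpos₃)
    (negIdxEquivEmpty hpos₃) (lineSign_three V c) (exists_isArchWeilDatum_lineSlot (R := Unit) (S := Empty)) x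

/-- line 2, twisted by the conjugated see-saw characters, at `((archSingle u_x)^𝔸, 1)` on the thin-coset test function of its vacuum:
the scalar `Λ₀″(u_x) · vacScalar e₂ (letterK x)`. -/
theorem cmConjLineRepFin₀_one_archSingle_uOfLetter_testFun (x : Matrix.unitaryGroup (PosIdx (cmXV (L : Type) (frameD V) (frameD_real V) ι₁ (cmPlace (L : Type) ι₁))) ℂ × Matrix.unitaryGroup (NegIdx (cmXV (L : Type) (frameD V) (frameD_real V) ι₁ (cmPlace (L : Type) ι₁))) ℂ) (x₂ : Fin 3 → ↥(maximalRealSubfield L)) (N : ℕ) :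
    cmConjLineRepFin₀ (L : Type) finProdFinEquiv e₁ (frameD V) (frameD_real V) (frameD_ne V) (dW c.D) (dW_real c.D) (dW_ne c.D)
        (dW' c.D) (dW'_real c.D) (dW'_ne c.D) c.D.isoGL (isoGL_hg₀ c.D) hGR hGR₂ hGR₃ 1
        (UnitaryGroup.archToAdelic (↥(maximalRealSubfield L)) L (IsCMField.complexConj L) 3 (Matrix.diagonal (frameD V))
          (UnitaryGroup.archSingle (↥(maximalRealSubfield L)) L (IsCMField.complexConj L) 3 (Matrix.diagonal (frameD V))
            (IsCMField.complexConj_ne_one L) (UnitaryGroup.complexConj_smul_infinitePlace (L : Type)) (cmPlaceOver (L : Type) (cmPlace (L : Type) ι₁))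
            (uOfLetter (L : Type) (frameD V) (frameD_real V) (frameD_ne V) (dW c.D) (dW_real c.D) (dW_ne c.D) ι₁ (cmPlace (L : Type) ι₁) x)), 1)
        (testFun (↥(maximalRealSubfield L)) (Fin 3) (follandFock (cmBigFrame (L : Type) e₁ (frameD V) (frameD_real V) (frameD_ne V) (lineVec (L : Type) (dW' c.D 0)) (fun _ => dW'_real c.D 0) (fun _ => dW'_ne c.D 0) ι₁) 1) x₂ N) =
      ((((defLambdaCharConj V c.D hGR hGR₂ hGR₃ (cmPlace (L : Type) ι₁) (uOfLetter (L : Type) (frameD V) (frameD_real V) (frameD_ne V) (dW c.D) (dW_real c.D) (dW_ne c.D) ι₁ (cmPlace (L : Type) ι₁) x)) : ℂˣ) : ℂ) *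
          vacScalar (lineVacExponentsTwo V c hGR₂ (posIdxEquivUnit hpos₂) (negIdxEquivEmpty hpos₂)) (letterK V x : DPK (Fin 2) Unit Unit Empty)) •
        testFun (↥(maximalRealSubfield L)) (Fin 3) (follandFock (cmBigFrame (L : Type) e₁ (frameD V) (frameD_real V) (frameD_ne V) (lineVec (L : Type) (dW' c.D 0)) (fun _ => dW'_real c.D 0) (fun _ => dW'_ne c.D 0) ι₁) 1) x₂ N := by
  have key := cmPairRep_archToAdelic_eq_adelicTensorEnd (L : Type) e₁ (frameD V) (frameD_real V) (frameD_ne V)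
    (lineVec (L : Type) (dW' c.D 0)) (fun _ => dW'_real c.D 0) (fun _ => dW'_ne c.D 0) hGR₂
    (UnitaryGroup.archSingle (↥(maximalRealSubfield L)) L (IsCMField.complexConj L) 3 (Matrix.diagonal (frameD V))
            (IsCMField.complexConj_ne_one L) (UnitaryGroup.complexConj_smul_infinitePlace (L : Type)) (cmPlaceOver (L : Type) (cmPlace (L : Type) ι₁))
            (uOfLetter (L : Type) (frameD V) (frameD_real V) (frameD_ne V) (dW c.D) (dW_real c.D) (dW_ne c.D) ι₁ (cmPlace (L : Type) ι₁) x)) 1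
  rw [map_one] at key
  have key2 := apply_testFun_of_eq_adelicTensorEnd key (follandFock (cmBigFrame (L : Type) e₁ (frameD V) (frameD_real V) (frameD_ne V) (lineVec (L : Type) (dW' c.D 0)) (fun _ => dW'_real c.D 0) (fun _ => dW'_ne c.D 0) ι₁) 1) x₂ N
  rw [cmArchWeilRep_two_archSingle_uOfLetter_follandFock_one V c hGR₂ hpos₂, testFun_smul] at key2
  rw [cmConjLineRepFin₀_apply_eq_smul_cmPairRep, map_one, map_one, MonoidHom.one_apply, one_mul, ← defLambdaCharConj_apply]
  erw [key2]
  rw [smul_smul]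

/-- line 3 at `((archSingle u_x)^𝔸, 1)` on the thin-coset test function of its vacuum: the scalar `vacScalar e₃ (letterK x)`. -/
theorem cmConjLineRepFin₁_one_archSingle_uOfLetter_testFun (x : Matrix.unitaryGroup (PosIdx (cmXV (L : Type) (frameD V) (frameD_real V) ι₁ (cmPlace (L : Type) ι₁))) ℂ × Matrix.unitaryGroup (NegIdx (cmXV (L : Type) (frameD V) (frameD_real V) ι₁ (cmPlace (L : Type) ι₁))) ℂ) (x₃ : Fin 3 → ↥(maximalRealSubfield L)) (N : ℕ) :
    cmConjLineRepFin₁ (L : Type) finProdFinEquiv e₁ (frameD V) (frameD_real V) (frameD_ne V) (dW c.D) (dW_real c.D) (dW_ne c.D)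
        (dW' c.D) (dW'_real c.D) (dW'_ne c.D) c.D.isoGL (isoGL_hg₀ c.D) hGR hGR₂ hGR₃ 1
        (UnitaryGroup.archToAdelic (↥(maximalRealSubfield L)) L (IsCMField.complexConj L) 3 (Matrix.diagonal (frameD V))
          (UnitaryGroup.archSingle (↥(maximalRealSubfield L)) L (IsCMField.complexConj L) 3 (Matrix.diagonal (frameD V))
            (IsCMField.complexConj_ne_one L) (UnitaryGroup.complexConj_smul_infinitePlace (L : Type)) (cmPlaceOver (L : Type) (cmPlace (L : Type) ι₁))
            (uOfLetter (L : Type) (frameD V) (frameD_real V) (frameD_ne V) (dW c.D) (dW_real c.D) (dW_ne c.D) ι₁ (cmPlace (L : Type) ι₁) x)), 1)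
        (testFun (↥(maximalRealSubfield L)) (Fin 3) (follandFock (cmBigFrame (L : Type) e₁ (frameD V) (frameD_real V) (frameD_ne V) (lineVec (L : Type) (dW' c.D 1)) (fun _ => dW'_real c.D 1) (fun _ => dW'_ne c.D 1) ι₁) 1) x₃ N) =
      vacScalar (lineVacExponentsThree V c hGR₃ (posIdxEquivUnit hpos₃) (negIdxEquivEmpty hpos₃)) (letterK V x : DPK (Fin 2) Unit Unit Empty) •
        testFun (↥(maximalRealSubfield L)) (Fin 3) (follandFock (cmBigFrame (L : Type) e₁ (frameD V) (frameD_real V) (frameD_ne V) (lineVec (L : Type) (dW' c.D 1)) (fun _ => dW'_real c.D 1) (fun _ => dW'_ne c.D 1) ι₁) 1) x₃ N := by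
  have key := cmPairRep_archToAdelic_eq_adelicTensorEnd (L : Type) e₁ (frameD V) (frameD_real V) (frameD_ne V)
    (lineVec (L : Type) (dW' c.D 1)) (fun _ => dW'_real c.D 1) (fun _ => dW'_ne c.D 1) hGR₃
    (UnitaryGroup.archSingle (↥(maximalRealSubfield L)) L (IsCMField.complexConj L) 3 (Matrix.diagonal (frameD V))
            (IsCMField.complexConj_ne_one L) (UnitaryGroup.complexConj_smul_infinitePlace (L : Type)) (cmPlaceOver (L : Type) (cmPlace (L : Type) ι₁))
            (uOfLetter (L : Type) (frameD V) (frameD_real V) (frameD_ne V) (dW c.D) (dW_real c.D) (dW_ne c.D) ι₁ (cmPlace (L : Type) ι₁) x)) 1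
  rw [map_one] at key
  have key2 := apply_testFun_of_eq_adelicTensorEnd key (follandFock (cmBigFrame (L : Type) e₁ (frameD V) (frameD_real V) (frameD_ne V) (lineVec (L : Type) (dW' c.D 1)) (fun _ => dW'_real c.D 1) (fun _ => dW'_ne c.D 1) ι₁) 1) x₃ N
  rw [cmArchWeilRep_three_archSingle_uOfLetter_follandFock_one V c hGR₃ hpos₃, testFun_smul] at key2
  rw [cmConjLineRepFin₁_apply_eq_smul_cmPairRep, map_one, map_one, MonoidHom.one_apply, one_mul, cmConjLineChar₁_apply_mk_one, Units.val_one,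
    one_smul]
  erw [key2]

/-! ## § 2 The big pair on the transported vacuum `Y = a • ω_∞(1, k)(follandFock 𝔢 1)` at a `v₁`-letter -/

/-- **`ω_∞(u_x, 1) Y = pinLetterChar(x) • Y`** for `Y = a • ω_∞(hGR)(1, conjTransportK c.D)(follandFock 𝔢 1)`: `(u_x, 1)` and `(1, k)` commute in the
representation of the product group, and binder-2 #72 on the pair's vacuum. -/
theorem cmArchWeilRep_archSingle_uOfLetter_of_vt₁ (Y : 𝓢((Fin (3 * 2) → mixedSpace (↥(NumberField.maximalRealSubfield (L : Type)))), ℂ)) (a : ℂ)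
    (hY : Y = a • cmArchWeilRep (L : Type) finProdFinEquiv (frameD V) (frameD_real V) (frameD_ne V) (dW c.D) (dW_real c.D) (dW_ne c.D) hGR (1, conjTransportK c.D) (follandFock (cmBigFrame (L : Type) finProdFinEquiv (frameD V) (frameD_real V) (frameD_ne V) (dW c.D) (dW_real c.D) (dW_ne c.D) ι₁) 1))
    (x : Matrix.unitaryGroup (PosIdx (cmXV (L : Type) (frameD V) (frameD_real V) ι₁ (cmPlace (L : Type) ι₁))) ℂ × Matrix.unitaryGroup (NegIdx (cmXV (L : Type) (frameD V) (frameD_real V) ι₁ (cmPlace (L : Type) ι₁))) ℂ) :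
    cmArchWeilRep (L : Type) finProdFinEquiv (frameD V) (frameD_real V) (frameD_ne V) (dW c.D) (dW_real c.D) (dW_ne c.D) hGR
        (UnitaryGroup.archSingle (↥(maximalRealSubfield L)) L (IsCMField.complexConj L) 3 (Matrix.diagonal (frameD V))
            (IsCMField.complexConj_ne_one L) (UnitaryGroup.complexConj_smul_infinitePlace (L : Type)) (cmPlaceOver (L : Type) (cmPlace (L : Type) ι₁))
            (uOfLetter (L : Type) (frameD V) (frameD_real V) (frameD_ne V) (dW c.D) (dW_real c.D) (dW_ne c.D) ι₁ (cmPlace (L : Type) ι₁) x), 1) Y =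
      ((pinLetterChar V c.D hGR h₁W (kVLetters V c.D (Pi.mulSingle (cmPlace (L : Type) ι₁) x)) : Circle) : ℂ) • Y := by
  subst hY
  have hcomm : ((UnitaryGroup.archSingle (↥(maximalRealSubfield L)) L (IsCMField.complexConj L) 3 (Matrix.diagonal (frameD V))
            (IsCMField.complexConj_ne_one L) (UnitaryGroup.complexConj_smul_infinitePlace (L : Type)) (cmPlaceOver (L : Type) (cmPlace (L : Type) ι₁))
            (uOfLetter (L : Type) (frameD V) (frameD_real V) (frameD_ne V) (dW c.D) (dW_real c.D) (dW_ne c.D) ι₁ (cmPlace (L : Type) ι₁) x), 1) :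
        UnitaryGroup.arch (↥(maximalRealSubfield L)) L (IsCMField.complexConj L) 3 (Matrix.diagonal (frameD V)) ×
          UnitaryGroup.arch (↥(maximalRealSubfield L)) L (IsCMField.complexConj L) 2 (Matrix.diagonal (dW c.D))) * (1, conjTransportK c.D) =
      (1, conjTransportK c.D) * (UnitaryGroup.archSingle (↥(maximalRealSubfield L)) L (IsCMField.complexConj L) 3 (Matrix.diagonal (frameD V))
            (IsCMField.complexConj_ne_one L) (UnitaryGroup.complexConj_smul_infinitePlace (L : Type)) (cmPlaceOver (L : Type) (cmPlace (L : Type) ι₁))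
            (uOfLetter (L : Type) (frameD V) (frameD_real V) (frameD_ne V) (dW c.D) (dW_real c.D) (dW_ne c.D) ι₁ (cmPlace (L : Type) ι₁) x), 1) := by
    rw [Prod.mk_mul_mk, Prod.mk_mul_mk, one_mul, mul_one, one_mul, mul_one]
  have hswap : cmArchWeilRep (L : Type) finProdFinEquiv (frameD V) (frameD_real V) (frameD_ne V) (dW c.D) (dW_real c.D) (dW_ne c.D) hGR
        (UnitaryGroup.archSingle (↥(maximalRealSubfield L)) L (IsCMField.complexConj L) 3 (Matrix.diagonal (frameD V))
            (IsCMField.complexConj_ne_one L) (UnitaryGroup.complexConj_smul_infinitePlace (L : Type)) (cmPlaceOver (L : Type) (cmPlace (L : Type) ι₁))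
            (uOfLetter (L : Type) (frameD V) (frameD_real V) (frameD_ne V) (dW c.D) (dW_real c.D) (dW_ne c.D) ι₁ (cmPlace (L : Type) ι₁) x), 1)
        (cmArchWeilRep (L : Type) finProdFinEquiv (frameD V) (frameD_real V) (frameD_ne V) (dW c.D) (dW_real c.D) (dW_ne c.D) hGR (1, conjTransportK c.D) (follandFock (cmBigFrame (L : Type) finProdFinEquiv (frameD V) (frameD_real V) (frameD_ne V) (dW c.D) (dW_real c.D) (dW_ne c.D) ι₁) 1)) =
      cmArchWeilRep (L : Type) finProdFinEquiv (frameD V) (frameD_real V) (frameD_ne V) (dW c.D) (dW_real c.D) (dW_ne c.D) hGR (1, conjTransportK c.D)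
        (cmArchWeilRep (L : Type) finProdFinEquiv (frameD V) (frameD_real V) (frameD_ne V) (dW c.D) (dW_real c.D) (dW_ne c.D) hGR
          (UnitaryGroup.archSingle (↥(maximalRealSubfield L)) L (IsCMField.complexConj L) 3 (Matrix.diagonal (frameD V))
            (IsCMField.complexConj_ne_one L) (UnitaryGroup.complexConj_smul_infinitePlace (L : Type)) (cmPlaceOver (L : Type) (cmPlace (L : Type) ι₁))
            (uOfLetter (L : Type) (frameD V) (frameD_real V) (frameD_ne V) (dW c.D) (dW_real c.D) (dW_ne c.D) ι₁ (cmPlace (L : Type) ι₁) x), 1)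
          (follandFock (cmBigFrame (L : Type) finProdFinEquiv (frameD V) (frameD_real V) (frameD_ne V) (dW c.D) (dW_real c.D) (dW_ne c.D) ι₁) 1)) := by
    rw [← Module.End.mul_apply, ← map_mul, hcomm, map_mul, Module.End.mul_apply]
  rw [LinearMap.map_smul, hswap, cmArchWeilRep_archSingle_uOfLetter_follandFock_one V c.D hGR h₁W (cmPlace (L : Type) ι₁) x, LinearMap.map_smul,
    smul_comm]

/-! ## § 3 The pin's letter character from the CONJUGATED see-saw, and `Λ₀″` on a `v₁`-letter -/

/-- **(C-Σ)′ AT `v₁`, RAW FORM**: `pinLetterChar (kVLetters (mulSingle v₁ x)) = Λ₀″(u_x) · vacScalar e₂ (letterK x) · vacScalar e₃ (letterK x)` from the see-saw of the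
two conjugated line vacua, given the vacuum (STRIP) ∧ (VT) `hSV₁`. -/
theorem pinLetterChar_kVLetters_mulSingle_cmPlace_eq_conj_of_strip_vt
    (hSV₁ : ∀ x₂ x₃ : Fin 3 → ↥(maximalRealSubfield L),
      ∃ (Y : 𝓢((Fin (3 * 2) → mixedSpace (↥(NumberField.maximalRealSubfield (L : Type)))), ℂ))
        (F : FinSB (↥(NumberField.maximalRealSubfield (L : Type))) (Fin (3 * 2))) (a : ℂ),
        cmConjLineTensorFin (L : Type) finProdFinEquiv e₁ (frameD V) (frameD_real V) (frameD_ne V) (dW c.D) (dW_real c.D) (dW_ne c.D)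
      (dW' c.D) (dW'_real c.D) (dW'_ne c.D) c.D.isoGL (isoGL_hg₀ c.D)
            (testFun (↥(maximalRealSubfield L)) (Fin 3) (follandFock (cmBigFrame (L : Type) e₁ (frameD V) (frameD_real V) (frameD_ne V) (lineVec (L : Type) (dW' c.D 0)) (fun _ => dW'_real c.D 0) (fun _ => dW'_ne c.D 0) ι₁) 1) x₂ 1)
            (testFun (↥(maximalRealSubfield L)) (Fin 3) (follandFock (cmBigFrame (L : Type) e₁ (frameD V) (frameD_real V) (frameD_ne V) (lineVec (L : Type) (dW' c.D 1)) (fun _ => dW'_real c.D 1) (fun _ => dW'_ne c.D 1) ι₁) 1) x₃ 1) =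
          piSchwartzBruhatEquiv (↥(NumberField.maximalRealSubfield (L : Type))) (Fin (3 * 2)) (Y ⊗ₜ F) ∧
        Y = a • cmArchWeilRep (L : Type) finProdFinEquiv (frameD V) (frameD_real V) (frameD_ne V) (dW c.D) (dW_real c.D) (dW_ne c.D) hGR (1, conjTransportK c.D) (follandFock (cmBigFrame (L : Type) finProdFinEquiv (frameD V) (frameD_real V) (frameD_ne V) (dW c.D) (dW_real c.D) (dW_ne c.D) ι₁) 1))
    (x : Matrix.unitaryGroup (PosIdx (cmXV (L : Type) (frameD V) (frameD_real V) ι₁ (cmPlace (L : Type) ι₁))) ℂ × Matrix.unitaryGroup (NegIdx (cmXV (L : Type) (frameD V) (frameD_real V) ι₁ (cmPlace (L : Type) ι₁))) ℂ) :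
    ((pinLetterChar V c.D hGR h₁W (kVLetters V c.D (Pi.mulSingle (cmPlace (L : Type) ι₁) x)) : Circle) : ℂ) =
      (((defLambdaCharConj V c.D hGR hGR₂ hGR₃ (cmPlace (L : Type) ι₁) (uOfLetter (L : Type) (frameD V) (frameD_real V) (frameD_ne V) (dW c.D) (dW_real c.D) (dW_ne c.D) ι₁ (cmPlace (L : Type) ι₁) x)) : ℂˣ) : ℂ) *
        vacScalar (lineVacExponentsTwo V c hGR₂ (posIdxEquivUnit hpos₂) (negIdxEquivEmpty hpos₂)) (letterK V x : DPK (Fin 2) Unit Unit Empty) *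
        vacScalar (lineVacExponentsThree V c hGR₃ (posIdxEquivUnit hpos₃) (negIdxEquivEmpty hpos₃)) (letterK V x : DPK (Fin 2) Unit Unit Empty) := by
  -- rational points where the two vacua do not vanish, and the (non-zero) conjugated see-saw tensor
  obtain ⟨x₂, hx₂⟩ := exists_apply_archEmb_ne_zero (↥(maximalRealSubfield L)) (Fin 3) (follandFock (cmBigFrame (L : Type) e₁ (frameD V) (frameD_real V) (frameD_ne V) (lineVec (L : Type) (dW' c.D 0)) (fun _ => dW'_real c.D 0) (fun _ => dW'_ne c.D 0) ι₁) 1) (follandFock_one_ne_zero _)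
  obtain ⟨x₃, hx₃⟩ := exists_apply_archEmb_ne_zero (↥(maximalRealSubfield L)) (Fin 3) (follandFock (cmBigFrame (L : Type) e₁ (frameD V) (frameD_real V) (frameD_ne V) (lineVec (L : Type) (dW' c.D 1)) (fun _ => dW'_real c.D 1) (fun _ => dW'_ne c.D 1) ι₁) 1) (follandFock_one_ne_zero _)
  have hφ₂ : testFun (↥(maximalRealSubfield L)) (Fin 3) (follandFock (cmBigFrame (L : Type) e₁ (frameD V) (frameD_real V) (frameD_ne V) (lineVec (L : Type) (dW' c.D 0)) (fun _ => dW'_real c.D 0) (fun _ => dW'_ne c.D 0) ι₁) 1) x₂ 1 ≠ 0 := testFun_ne_zero _ hx₂ one_ne_zero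
  have hφ₃ : testFun (↥(maximalRealSubfield L)) (Fin 3) (follandFock (cmBigFrame (L : Type) e₁ (frameD V) (frameD_real V) (frameD_ne V) (lineVec (L : Type) (dW' c.D 1)) (fun _ => dW'_real c.D 1) (fun _ => dW'_ne c.D 1) ι₁) 1) x₃ 1 ≠ 0 := testFun_ne_zero _ hx₃ one_ne_zero
  have hX := cmConjLineTensorFin_ne_zero V c.D hφ₂ hφ₃
  -- the conjugated see-saw restriction at `((archSingle u_x)^𝔸, g·diag(1,1)·g⁻¹)`, trivial twists
  have hss := cmPairRepTwist_conjTorusIdeles_cmConjLineTensorFin (L : Type) finProdFinEquiv e₁ (frameD V) (frameD_real V) (frameD_ne V)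
    (dW c.D) (dW_real c.D) (dW_ne c.D) (dW' c.D) (dW'_real c.D) (dW'_ne c.D) c.D.isoGL (isoGL_hg₀ c.D) hGR hGR₂ hGR₃ 1 1 1
    (fun _ _ _ => by rw [MonoidHom.one_apply, MonoidHom.one_apply, MonoidHom.one_apply, one_mul])
    (UnitaryGroup.archToAdelic (↥(maximalRealSubfield L)) L (IsCMField.complexConj L) 3 (Matrix.diagonal (frameD V))
          (UnitaryGroup.archSingle (↥(maximalRealSubfield L)) L (IsCMField.complexConj L) 3 (Matrix.diagonal (frameD V))
            (IsCMField.complexConj_ne_one L) (UnitaryGroup.complexConj_smul_infinitePlace (L : Type)) (cmPlaceOver (L : Type) (cmPlace (L : Type) ι₁))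
            (uOfLetter (L : Type) (frameD V) (frameD_real V) (frameD_ne V) (dW c.D) (dW_real c.D) (dW_ne c.D) ι₁ (cmPlace (L : Type) ι₁) x))) 1 1
    (testFun (↥(maximalRealSubfield L)) (Fin 3) (follandFock (cmBigFrame (L : Type) e₁ (frameD V) (frameD_real V) (frameD_ne V) (lineVec (L : Type) (dW' c.D 0)) (fun _ => dW'_real c.D 0) (fun _ => dW'_ne c.D 0) ι₁) 1) x₂ 1)
    (testFun (↥(maximalRealSubfield L)) (Fin 3) (follandFock (cmBigFrame (L : Type) e₁ (frameD V) (frameD_real V) (frameD_ne V) (lineVec (L : Type) (dW' c.D 1)) (fun _ => dW'_real c.D 1) (fun _ => dW'_ne c.D 1) ι₁) 1) x₃ 1)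
  have h11 : cmConjPlaneTorusIdeles (L : Type) (dW c.D) (dW' c.D) c.D.isoGL (isoGL_hg₀ c.D) (1, 1) = 1 := map_one _
  rw [cmPairRepTwist_apply_eq_smul, MonoidHom.one_apply, Units.val_one, one_smul, h11,
    cmConjLineRepFin₀_one_archSingle_uOfLetter_testFun V c hGR hGR₂ hGR₃ hpos₂ (x := x) x₂ 1,
    cmConjLineRepFin₁_one_archSingle_uOfLetter_testFun V c hGR hGR₂ hGR₃ hpos₃ (x := x) x₃ 1, LinearMap.map_smul₂, LinearMap.map_smul,
    smul_smul] at hss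
  -- the big side on the same vector, through the vacuum (STRIP) ∧ (VT)
  obtain ⟨Y, F, a, hstrip, hY⟩ := hSV₁ x₂ x₃
  have key := cmPairRep_archToAdelic_eq_adelicTensorEnd (L : Type) finProdFinEquiv (frameD V) (frameD_real V) (frameD_ne V) (dW c.D)
    (dW_real c.D) (dW_ne c.D) hGR
    (UnitaryGroup.archSingle (↥(maximalRealSubfield L)) L (IsCMField.complexConj L) 3 (Matrix.diagonal (frameD V))
            (IsCMField.complexConj_ne_one L) (UnitaryGroup.complexConj_smul_infinitePlace (L : Type)) (cmPlaceOver (L : Type) (cmPlace (L : Type) ι₁))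
            (uOfLetter (L : Type) (frameD V) (frameD_real V) (frameD_ne V) (dW c.D) (dW_real c.D) (dW_ne c.D) ι₁ (cmPlace (L : Type) ι₁) x)) 1
  rw [map_one] at key
  have hbig := LinearMap.congr_fun key
    (cmConjLineTensorFin (L : Type) finProdFinEquiv e₁ (frameD V) (frameD_real V) (frameD_ne V) (dW c.D) (dW_real c.D) (dW_ne c.D)
      (dW' c.D) (dW'_real c.D) (dW'_ne c.D) c.D.isoGL (isoGL_hg₀ c.D)
      (testFun (↥(maximalRealSubfield L)) (Fin 3) (follandFock (cmBigFrame (L : Type) e₁ (frameD V) (frameD_real V) (frameD_ne V) (lineVec (L : Type) (dW' c.D 0)) (fun _ => dW'_real c.D 0) (fun _ => dW'_ne c.D 0) ι₁) 1) x₂ 1)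
      (testFun (↥(maximalRealSubfield L)) (Fin 3) (follandFock (cmBigFrame (L : Type) e₁ (frameD V) (frameD_real V) (frameD_ne V) (lineVec (L : Type) (dW' c.D 1)) (fun _ => dW'_real c.D 1) (fun _ => dW'_ne c.D 1) ι₁) 1) x₃ 1))
  rw [hstrip, adelicTensorEnd_apply_tmul, LinearMap.id_apply, cmArchWeilRep_archSingle_uOfLetter_of_vt₁ V c hGR h₁W Y a hY x,
    ← TensorProduct.smul_tmul', map_smul, ← hstrip] at hbig
  -- compare
  erw [hbig] at hss
  exact smul_left_injective ℂ hX hss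

/-- **`Λ₀″` ON A `v₁`-LETTER**: `defLambdaCharConj … v₁ (u_x) = tw(det A · det D)^{ℓ″}`, `ℓ″ = lambdaExponentConj` (#CA51) — twin of #CA38 § 3. -/
theorem defLambdaCharConj_cmPlace_uOfLetter (x : Matrix.unitaryGroup (PosIdx (cmXV (L : Type) (frameD V) (frameD_real V) ι₁ (cmPlace (L : Type) ι₁))) ℂ × Matrix.unitaryGroup (NegIdx (cmXV (L : Type) (frameD V) (frameD_real V) ι₁ (cmPlace (L : Type) ι₁))) ℂ) :
    (((defLambdaCharConj V c.D hGR hGR₂ hGR₃ (cmPlace (L : Type) ι₁) (uOfLetter (L : Type) (frameD V) (frameD_real V) (frameD_ne V) (dW c.D) (dW_real c.D) (dW_ne c.D) ι₁ (cmPlace (L : Type) ι₁) x)) : ℂˣ) : ℂ) =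
      embTwist (L : Type) ι₁ (((x.1 : Matrix.unitaryGroup (PosIdx (cmXV (L : Type) (frameD V) (frameD_real V) ι₁ (cmPlace (L : Type) ι₁))) ℂ) : Matrix (PosIdx (cmXV (L : Type) (frameD V) (frameD_real V) ι₁ (cmPlace (L : Type) ι₁))) (PosIdx (cmXV (L : Type) (frameD V) (frameD_real V) ι₁ (cmPlace (L : Type) ι₁))) ℂ).det * ((x.2 : Matrix.unitaryGroup (NegIdx (cmXV (L : Type) (frameD V) (frameD_real V) ι₁ (cmPlace (L : Type) ι₁))) ℂ) : Matrix (NegIdx (cmXV (L : Type) (frameD V) (frameD_real V) ι₁ (cmPlace (L : Type) ι₁))) (NegIdx (cmXV (L : Type) (frameD V) (frameD_real V) ι₁ (cmPlace (L : Type) ι₁))) ℂ).det) ^ lambdaExponentConj V c.D hGR hGR₂ hGR₃ h₁W := by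
  have hmem : archProjU21EmbCM (L : Type) V.Hm ι₁ V.sylvesterFrame (sylvesterFrame_formCongr V)
      (lettInvArch V c.D (Pi.mulSingle (cmPlace (L : Type) ι₁) x)) ∈ MulAction.stabilizer U21 x₀ :=
    Subgroup.mem_comap.mp (lettInvArch_mem V c.D (Pi.mulSingle (cmPlace (L : Type) ι₁) x))
  rw [defLambdaCharConj_apply, archSingle_uOfLetter_cmPlace_eq_archSectionFrameOf V c.D x, ← lambdaCharConj_apply V c.D hGR hGR₂ hGR₃,
    show archProjU21EmbCM (L : Type) V.Hm ι₁ V.sylvesterFrame (sylvesterFrame_formCongr V)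
      (lettInvArch V c.D (Pi.mulSingle (cmPlace (L : Type) ι₁) x)) = ((⟨_, hmem⟩ : MulAction.stabilizer U21 x₀) : U21) from rfl,
    lambdaCharConj_stabilizer V c.D hGR hGR₂ hGR₃ h₁W, ← det_mat_stabilizer]
  congr 1
  have h1 := det_coe_uOfLetter_cmPlace V c.D x
  rw [det_coe_uOfLetter] at h1
  have h2 := congrArg (embTwist (L : Type) ι₁) h1
  rw [embTwist_embTwist] at h2
  exact h2.symm

/-- **THE PIN'S LETTER CHARACTER FROM THE CONJUGATED LINES, CLOSED FORM**:
`pinLetterChar (kVLetters (mulSingle v₁ (A, D))) = tw(det A·det D)^{ℓ″} · (det A^{e_P²} det D^{e_Q²}) · (det A^{e_P³} det D^{e_Q³})`. -/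
theorem pinLetterChar_kVLetters_mulSingle_cmPlace_conj_of_strip_vt
    (hSV₁ : ∀ x₂ x₃ : Fin 3 → ↥(maximalRealSubfield L),
      ∃ (Y : 𝓢((Fin (3 * 2) → mixedSpace (↥(NumberField.maximalRealSubfield (L : Type)))), ℂ))
        (F : FinSB (↥(NumberField.maximalRealSubfield (L : Type))) (Fin (3 * 2))) (a : ℂ),
        cmConjLineTensorFin (L : Type) finProdFinEquiv e₁ (frameD V) (frameD_real V) (frameD_ne V) (dW c.D) (dW_real c.D) (dW_ne c.D)
      (dW' c.D) (dW'_real c.D) (dW'_ne c.D) c.D.isoGL (isoGL_hg₀ c.D)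
            (testFun (↥(maximalRealSubfield L)) (Fin 3) (follandFock (cmBigFrame (L : Type) e₁ (frameD V) (frameD_real V) (frameD_ne V) (lineVec (L : Type) (dW' c.D 0)) (fun _ => dW'_real c.D 0) (fun _ => dW'_ne c.D 0) ι₁) 1) x₂ 1)
            (testFun (↥(maximalRealSubfield L)) (Fin 3) (follandFock (cmBigFrame (L : Type) e₁ (frameD V) (frameD_real V) (frameD_ne V) (lineVec (L : Type) (dW' c.D 1)) (fun _ => dW'_real c.D 1) (fun _ => dW'_ne c.D 1) ι₁) 1) x₃ 1) =
          piSchwartzBruhatEquiv (↥(NumberField.maximalRealSubfield (L : Type))) (Fin (3 * 2)) (Y ⊗ₜ F) ∧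
        Y = a • cmArchWeilRep (L : Type) finProdFinEquiv (frameD V) (frameD_real V) (frameD_ne V) (dW c.D) (dW_real c.D) (dW_ne c.D) hGR (1, conjTransportK c.D) (follandFock (cmBigFrame (L : Type) finProdFinEquiv (frameD V) (frameD_real V) (frameD_ne V) (dW c.D) (dW_real c.D) (dW_ne c.D) ι₁) 1))
    (x : Matrix.unitaryGroup (PosIdx (cmXV (L : Type) (frameD V) (frameD_real V) ι₁ (cmPlace (L : Type) ι₁))) ℂ × Matrix.unitaryGroup (NegIdx (cmXV (L : Type) (frameD V) (frameD_real V) ι₁ (cmPlace (L : Type) ι₁))) ℂ) :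
    ((pinLetterChar V c.D hGR h₁W (kVLetters V c.D (Pi.mulSingle (cmPlace (L : Type) ι₁) x)) : Circle) : ℂ) =
      embTwist (L : Type) ι₁ (((x.1 : Matrix.unitaryGroup (PosIdx (cmXV (L : Type) (frameD V) (frameD_real V) ι₁ (cmPlace (L : Type) ι₁))) ℂ) : Matrix (PosIdx (cmXV (L : Type) (frameD V) (frameD_real V) ι₁ (cmPlace (L : Type) ι₁))) (PosIdx (cmXV (L : Type) (frameD V) (frameD_real V) ι₁ (cmPlace (L : Type) ι₁))) ℂ).det * ((x.2 : Matrix.unitaryGroup (NegIdx (cmXV (L : Type) (frameD V) (frameD_real V) ι₁ (cmPlace (L : Type) ι₁))) ℂ) : Matrix (NegIdx (cmXV (L : Type) (frameD V) (frameD_real V) ι₁ (cmPlace (L : Type) ι₁))) (NegIdx (cmXV (L : Type) (frameD V) (frameD_real V) ι₁ (cmPlace (L : Type) ι₁))) ℂ).det) ^ lambdaExponentConj V c.D hGR hGR₂ hGR₃ h₁W *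
        (((x.1 : Matrix.unitaryGroup (PosIdx (cmXV (L : Type) (frameD V) (frameD_real V) ι₁ (cmPlace (L : Type) ι₁))) ℂ) : Matrix (PosIdx (cmXV (L : Type) (frameD V) (frameD_real V) ι₁ (cmPlace (L : Type) ι₁))) (PosIdx (cmXV (L : Type) (frameD V) (frameD_real V) ι₁ (cmPlace (L : Type) ι₁))) ℂ).det ^ (lineVacExponentsTwo V c hGR₂ (posIdxEquivUnit hpos₂) (negIdxEquivEmpty hpos₂)).eP * ((x.2 : Matrix.unitaryGroup (NegIdx (cmXV (L : Type) (frameD V) (frameD_real V) ι₁ (cmPlace (L : Type) ι₁))) ℂ) : Matrix (NegIdx (cmXV (L : Type) (frameD V) (frameD_real V) ι₁ (cmPlace (L : Type) ι₁))) (NegIdx (cmXV (L : Type) (frameD V) (frameD_real V) ι₁ (cmPlace (L : Type) ι₁))) ℂ).det ^ (lineVacExponentsTwo V c hGR₂ (posIdxEquivUnit hpos₂) (negIdxEquivEmpty hpos₂)).eQ) *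
        (((x.1 : Matrix.unitaryGroup (PosIdx (cmXV (L : Type) (frameD V) (frameD_real V) ι₁ (cmPlace (L : Type) ι₁))) ℂ) : Matrix (PosIdx (cmXV (L : Type) (frameD V) (frameD_real V) ι₁ (cmPlace (L : Type) ι₁))) (PosIdx (cmXV (L : Type) (frameD V) (frameD_real V) ι₁ (cmPlace (L : Type) ι₁))) ℂ).det ^ (lineVacExponentsThree V c hGR₃ (posIdxEquivUnit hpos₃) (negIdxEquivEmpty hpos₃)).eP * ((x.2 : Matrix.unitaryGroup (NegIdx (cmXV (L : Type) (frameD V) (frameD_real V) ι₁ (cmPlace (L : Type) ι₁))) ℂ) : Matrix (NegIdx (cmXV (L : Type) (frameD V) (frameD_real V) ι₁ (cmPlace (L : Type) ι₁))) (NegIdx (cmXV (L : Type) (frameD V) (frameD_real V) ι₁ (cmPlace (L : Type) ι₁))) ℂ).det ^ (lineVacExponentsThree V c hGR₃ (posIdxEquivUnit hpos₃) (negIdxEquivEmpty hpos₃)).eQ) := by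
  rw [pinLetterChar_kVLetters_mulSingle_cmPlace_eq_conj_of_strip_vt V c hGR hGR₂ hGR₃ h₁W hpos₂ hpos₃ hSV₁,
    defLambdaCharConj_cmPlace_uOfLetter V c hGR hGR₂ hGR₃ h₁W, vacScalar_letterK, vacScalar_letterK]

/-! ## § 4 The identity of exponents -/

/-- exponent bookkeeping at the letter `(1, z)`: two closed forms of the same character value force `z^{(ℓ″+q₂+q₃) − (ℓ+q₀+q₁)} = 1`. -/
theorem iotaConj_bookkeeping {z : ℂ} (hz : z ≠ 0) {ℓ ℓ' p₀ q₀ p₁ q₁ p₂ q₂ p₃ q₃ : ℤ}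
    (h : z ^ ℓ' * ((1 : ℂ) ^ p₂ * z ^ q₂) * ((1 : ℂ) ^ p₃ * z ^ q₃) = z ^ ℓ * ((1 : ℂ) ^ p₀ * z ^ q₀) * ((1 : ℂ) ^ p₁ * z ^ q₁)) :
    z ^ (ℓ' + q₂ + q₃ - (ℓ + q₀ + q₁)) = 1 := by
  rw [one_zpow, one_zpow, one_zpow, one_zpow, one_mul, one_mul, one_mul, one_mul, ← zpow_add₀ hz, ← zpow_add₀ hz, ← zpow_add₀ hz,
    ← zpow_add₀ hz] at h
  rw [zpow_sub₀ hz, h, div_eq_one_iff_eq (zpow_ne_zero _ hz)]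

variable (hemb : (InfinitePlace.mk ι₁).embedding = ι₁)

include hemb in
/-- **(C-Σ)′ AT `v₁` — THE R1/R2 CONSISTENCY AT THE PLACE OF `ι₁`** (from the vacuum (STRIP) ∧ (VT) `hSV₁`, under E's guard):
`lambdaExponentConj + eP² + eP³ = lambdaExponent + eP⁰ + eP¹`. -/
theorem lambdaExponentConj_add_eq_of_strip_vt
    (hSV₁ : ∀ x₂ x₃ : Fin 3 → ↥(maximalRealSubfield L),
      ∃ (Y : 𝓢((Fin (3 * 2) → mixedSpace (↥(NumberField.maximalRealSubfield (L : Type)))), ℂ))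
        (F : FinSB (↥(NumberField.maximalRealSubfield (L : Type))) (Fin (3 * 2))) (a : ℂ),
        cmConjLineTensorFin (L : Type) finProdFinEquiv e₁ (frameD V) (frameD_real V) (frameD_ne V) (dW c.D) (dW_real c.D) (dW_ne c.D)
      (dW' c.D) (dW'_real c.D) (dW'_ne c.D) c.D.isoGL (isoGL_hg₀ c.D)
            (testFun (↥(maximalRealSubfield L)) (Fin 3) (follandFock (cmBigFrame (L : Type) e₁ (frameD V) (frameD_real V) (frameD_ne V) (lineVec (L : Type) (dW' c.D 0)) (fun _ => dW'_real c.D 0) (fun _ => dW'_ne c.D 0) ι₁) 1) x₂ 1)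
            (testFun (↥(maximalRealSubfield L)) (Fin 3) (follandFock (cmBigFrame (L : Type) e₁ (frameD V) (frameD_real V) (frameD_ne V) (lineVec (L : Type) (dW' c.D 1)) (fun _ => dW'_real c.D 1) (fun _ => dW'_ne c.D 1) ι₁) 1) x₃ 1) =
          piSchwartzBruhatEquiv (↥(NumberField.maximalRealSubfield (L : Type))) (Fin (3 * 2)) (Y ⊗ₜ F) ∧
        Y = a • cmArchWeilRep (L : Type) finProdFinEquiv (frameD V) (frameD_real V) (frameD_ne V) (dW c.D) (dW_real c.D) (dW_ne c.D) hGR (1, conjTransportK c.D) (follandFock (cmBigFrame (L : Type) finProdFinEquiv (frameD V) (frameD_real V) (frameD_ne V) (dW c.D) (dW_real c.D) (dW_ne c.D) ι₁) 1)) :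
    lambdaExponentConj V c.D hGR hGR₂ hGR₃ h₁W + (lineVacExponentsTwo V c hGR₂ (posIdxEquivUnit hpos₂) (negIdxEquivEmpty hpos₂)).eP + (lineVacExponentsThree V c hGR₃ (posIdxEquivUnit hpos₃) (negIdxEquivEmpty hpos₃)).eP =
      lambdaExponent V c.D hGR hGR₀ hGR₁ h₁W + (lineVacExponentsZero V c hGR₀ h₁W (posIdxEquivUnit hpos₀) (negIdxEquivEmpty hpos₀)).eP + (lineVacExponentsOne V c hGR₁ h₁W (posIdxEquivUnit hpos₁) (negIdxEquivEmpty hpos₁)).eP := by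
  haveI : Subsingleton (NegIdx (cmXV (L : Type) (frameD V) (frameD_real V) ι₁ (cmPlace (L : Type) ι₁))) := (blockNegEquiv V).subsingleton
  have key : ∀ z : ℂ, ‖z‖ = 1 → z ^ ((lambdaExponentConj V c.D hGR hGR₂ hGR₃ h₁W + (lineVacExponentsTwo V c hGR₂ (posIdxEquivUnit hpos₂) (negIdxEquivEmpty hpos₂)).eQ + (lineVacExponentsThree V c hGR₃ (posIdxEquivUnit hpos₃) (negIdxEquivEmpty hpos₃)).eQ) -
      (lambdaExponent V c.D hGR hGR₀ hGR₁ h₁W + (lineVacExponentsZero V c hGR₀ h₁W (posIdxEquivUnit hpos₀) (negIdxEquivEmpty hpos₀)).eQ + (lineVacExponentsOne V c hGR₁ h₁W (posIdxEquivUnit hpos₁) (negIdxEquivEmpty hpos₁)).eQ)) = 1 := by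
    intro z hz
    have hz0 : z ≠ 0 := norm_ne_zero_iff.mp (by rw [hz]; exact one_ne_zero)
    have hzz : z * conj z = 1 := by rw [Complex.mul_conj', hz]; norm_num
    -- the letter `(1, z)`
    have hDmem : z • (1 : Matrix (NegIdx (cmXV (L : Type) (frameD V) (frameD_real V) ι₁ (cmPlace (L : Type) ι₁))) (NegIdx (cmXV (L : Type) (frameD V) (frameD_real V) ι₁ (cmPlace (L : Type) ι₁))) ℂ) ∈ Matrix.unitaryGroup (NegIdx (cmXV (L : Type) (frameD V) (frameD_real V) ι₁ (cmPlace (L : Type) ι₁))) ℂ := by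
      rw [Matrix.mem_unitaryGroup_iff, Matrix.star_eq_conjTranspose, Matrix.conjTranspose_smul, Matrix.conjTranspose_one, Matrix.smul_mul,
        Matrix.one_mul, smul_smul, Complex.star_def, hzz, one_smul]
    let x : Matrix.unitaryGroup (PosIdx (cmXV (L : Type) (frameD V) (frameD_real V) ι₁ (cmPlace (L : Type) ι₁))) ℂ × Matrix.unitaryGroup (NegIdx (cmXV (L : Type) (frameD V) (frameD_real V) ι₁ (cmPlace (L : Type) ι₁))) ℂ := (1, ⟨z • (1 : Matrix (NegIdx (cmXV (L : Type) (frameD V) (frameD_real V) ι₁ (cmPlace (L : Type) ι₁))) (NegIdx (cmXV (L : Type) (frameD V) (frameD_real V) ι₁ (cmPlace (L : Type) ι₁))) ℂ), hDmem⟩)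
    have hA : ((x.1 : Matrix.unitaryGroup (PosIdx (cmXV (L : Type) (frameD V) (frameD_real V) ι₁ (cmPlace (L : Type) ι₁))) ℂ) : Matrix (PosIdx (cmXV (L : Type) (frameD V) (frameD_real V) ι₁ (cmPlace (L : Type) ι₁))) (PosIdx (cmXV (L : Type) (frameD V) (frameD_real V) ι₁ (cmPlace (L : Type) ι₁))) ℂ).det = 1 := by
      simp only [x, OneMemClass.coe_one, Matrix.det_one]
    have hD : ((x.2 : Matrix.unitaryGroup (NegIdx (cmXV (L : Type) (frameD V) (frameD_real V) ι₁ (cmPlace (L : Type) ι₁))) ℂ) : Matrix (NegIdx (cmXV (L : Type) (frameD V) (frameD_real V) ι₁ (cmPlace (L : Type) ι₁))) (NegIdx (cmXV (L : Type) (frameD V) (frameD_real V) ι₁ (cmPlace (L : Type) ι₁))) ℂ).det = z := by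
      rw [Matrix.det_eq_elem_of_subsingleton _ ((blockNegEquiv V).symm ())]
      simp [x]
    have h₁ := pinLetterChar_kVLetters_mulSingle_cmPlace V c hGR hGR₀ hGR₁ h₁W hpos₀ hpos₁ x
    have h₂ := pinLetterChar_kVLetters_mulSingle_cmPlace_conj_of_strip_vt V c hGR hGR₂ hGR₃ h₁W hpos₂ hpos₃ hSV₁ x
    rw [h₁, hA, hD, one_mul, embTwist_apply_of_eq (L : Type) ι₁ hemb] at h₂
    exact iotaConj_bookkeeping hz0 h₂.symm
  have h0 := int_eq_zero_of_forall_norm_one_zpow_eq_one _ key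
  have e₀ := lineVacExponentsZero_eP_sub_eQ V c hGR₀ h₁W (posIdxEquivUnit hpos₀) (negIdxEquivEmpty hpos₀)
  have e₁' := lineVacExponentsOne_eP_sub_eQ V c hGR₁ h₁W (posIdxEquivUnit hpos₁) (negIdxEquivEmpty hpos₁)
  have e₂ := lineVacExponentsTwo_eP_sub_eQ V c hGR₂ (posIdxEquivUnit hpos₂) (negIdxEquivEmpty hpos₂)
  have e₃ := lineVacExponentsThree_eP_sub_eQ V c hGR₃ (posIdxEquivUnit hpos₃) (negIdxEquivEmpty hpos₃)
  omega

/-! ## § 5 The R2 value at the place of `ι₁` -/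

include hemb in
/-- **THE TYPE THE (χ)₂ SOCKET NEEDS AT `w(ι₁)`**: the V-type read off lines 0, 1 equals `−eP² − eP³ − ℓ″` — so at pin R2, with the shared `χV := χVR`
(type `nVR`) and `ν′` of type `n₃R` (`n₃R (mk ι₁) = −eP³`, #CA49), the hypothesis `hm : m + ℓ″ + eP² = 0` of #CA51 `hχ_two_of_archType` holds for
`m := nVR (mk ι₁) − n₃R (mk ι₁)`. -/
theorem nVR_mk_eq_conj_of_strip_vt
    (hSV₁ : ∀ x₂ x₃ : Fin 3 → ↥(maximalRealSubfield L),
      ∃ (Y : 𝓢((Fin (3 * 2) → mixedSpace (↥(NumberField.maximalRealSubfield (L : Type)))), ℂ))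
        (F : FinSB (↥(NumberField.maximalRealSubfield (L : Type))) (Fin (3 * 2))) (a : ℂ),
        cmConjLineTensorFin (L : Type) finProdFinEquiv e₁ (frameD V) (frameD_real V) (frameD_ne V) (dW c.D) (dW_real c.D) (dW_ne c.D)
      (dW' c.D) (dW'_real c.D) (dW'_ne c.D) c.D.isoGL (isoGL_hg₀ c.D)
            (testFun (↥(maximalRealSubfield L)) (Fin 3) (follandFock (cmBigFrame (L : Type) e₁ (frameD V) (frameD_real V) (frameD_ne V) (lineVec (L : Type) (dW' c.D 0)) (fun _ => dW'_real c.D 0) (fun _ => dW'_ne c.D 0) ι₁) 1) x₂ 1)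
            (testFun (↥(maximalRealSubfield L)) (Fin 3) (follandFock (cmBigFrame (L : Type) e₁ (frameD V) (frameD_real V) (frameD_ne V) (lineVec (L : Type) (dW' c.D 1)) (fun _ => dW'_real c.D 1) (fun _ => dW'_ne c.D 1) ι₁) 1) x₃ 1) =
          piSchwartzBruhatEquiv (↥(NumberField.maximalRealSubfield (L : Type))) (Fin (3 * 2)) (Y ⊗ₜ F) ∧
        Y = a • cmArchWeilRep (L : Type) finProdFinEquiv (frameD V) (frameD_real V) (frameD_ne V) (dW c.D) (dW_real c.D) (dW_ne c.D) hGR (1, conjTransportK c.D) (follandFock (cmBigFrame (L : Type) finProdFinEquiv (frameD V) (frameD_real V) (frameD_ne V) (dW c.D) (dW_real c.D) (dW_ne c.D) ι₁) 1)) :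
    nVR V c hGR hGR₀ hGR₁ h₁W hpos₀ hpos₁ (InfinitePlace.mk ι₁) =
      -(lineVacExponentsTwo V c hGR₂ (posIdxEquivUnit hpos₂) (negIdxEquivEmpty hpos₂)).eP - (lineVacExponentsThree V c hGR₃ (posIdxEquivUnit hpos₃) (negIdxEquivEmpty hpos₃)).eP - lambdaExponentConj V c.D hGR hGR₂ hGR₃ h₁W := by
  have h := lambdaExponentConj_add_eq_of_strip_vt V c hGR hGR₀ hGR₁ hGR₂ hGR₃ h₁W hpos₀ hpos₁ hpos₂ hpos₃ hemb hSV₁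
  rw [nVR_mk]
  omega

include hemb in
/-- the same in socket form: `(nVR (mk ι₁) − n₃R (mk ι₁)) + ℓ″ + eP² = 0`. -/
theorem nVR_sub_n₃R_mk_of_strip_vt
    (hSV₁ : ∀ x₂ x₃ : Fin 3 → ↥(maximalRealSubfield L),
      ∃ (Y : 𝓢((Fin (3 * 2) → mixedSpace (↥(NumberField.maximalRealSubfield (L : Type)))), ℂ))
        (F : FinSB (↥(NumberField.maximalRealSubfield (L : Type))) (Fin (3 * 2))) (a : ℂ),
        cmConjLineTensorFin (L : Type) finProdFinEquiv e₁ (frameD V) (frameD_real V) (frameD_ne V) (dW c.D) (dW_real c.D) (dW_ne c.D)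
      (dW' c.D) (dW'_real c.D) (dW'_ne c.D) c.D.isoGL (isoGL_hg₀ c.D)
            (testFun (↥(maximalRealSubfield L)) (Fin 3) (follandFock (cmBigFrame (L : Type) e₁ (frameD V) (frameD_real V) (frameD_ne V) (lineVec (L : Type) (dW' c.D 0)) (fun _ => dW'_real c.D 0) (fun _ => dW'_ne c.D 0) ι₁) 1) x₂ 1)
            (testFun (↥(maximalRealSubfield L)) (Fin 3) (follandFock (cmBigFrame (L : Type) e₁ (frameD V) (frameD_real V) (frameD_ne V) (lineVec (L : Type) (dW' c.D 1)) (fun _ => dW'_real c.D 1) (fun _ => dW'_ne c.D 1) ι₁) 1) x₃ 1) =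
          piSchwartzBruhatEquiv (↥(NumberField.maximalRealSubfield (L : Type))) (Fin (3 * 2)) (Y ⊗ₜ F) ∧
        Y = a • cmArchWeilRep (L : Type) finProdFinEquiv (frameD V) (frameD_real V) (frameD_ne V) (dW c.D) (dW_real c.D) (dW_ne c.D) hGR (1, conjTransportK c.D) (follandFock (cmBigFrame (L : Type) finProdFinEquiv (frameD V) (frameD_real V) (frameD_ne V) (dW c.D) (dW_real c.D) (dW_ne c.D) ι₁) 1)) :
    nVR V c hGR hGR₀ hGR₁ h₁W hpos₀ hpos₁ (InfinitePlace.mk ι₁) - n₃R V c hGR₃ hpos₃ (InfinitePlace.mk ι₁) +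
        lambdaExponentConj V c.D hGR hGR₂ hGR₃ h₁W + (lineVacExponentsTwo V c hGR₂ (posIdxEquivUnit hpos₂) (negIdxEquivEmpty hpos₂)).eP = 0 := by
  rw [nVR_mk_eq_conj_of_strip_vt V c hGR hGR₀ hGR₁ hGR₂ hGR₃ h₁W hpos₀ hpos₁ hpos₂ hpos₃ hemb hSV₁, n₃R_mk]
  ring

end IotaConj

end HodgeCM.Model

end
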